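import Mathlib
import Summits.RiemannHypothesis.RiemannHypothesis.Theorems.WeilFarCoercivityFloor
import Summits.RiemannHypothesis.RiemannHypothesis.Theorems.WeilFarFloorCoshTest
import Summits.RiemannHypothesis.RiemannHypothesis.Theorems.WeilFarFloorWindowSmoothing
import Summits.RiemannHypothesis.RiemannHypothesis.Theorems.WeilFarFloorShiftFormLipschitz
import Summits.RiemannHypothesis.RiemannHypothesis.Theorems.WeilFarFloorArchBudget
import Literature.NumberTheory.LFunctions.WeilMarkovQuadratic
import Literature.NumberTheory.LFunctions.WeilExplicitProofs
import Literature.NumberTheory.LFunctions.WeilExplicitFormulaProofs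
import Literature.NumberTheory.LFunctions.WeilWindowSuzukiProofs
import Literature.NumberTheory.LFunctions.WeilArchDensityTail
import HarnessLib

/-!
# Under RH the prime-shift form splits along the cosh profile: the `O(1)` ceiling on every linear-modulus class

Helper file (`--supports stmt-RiemannHypothesis-0098`, lead-track anchor: Weil-positivity window ladder, format-C far bound),
pure proofs.  Seat rh-explicit-weil-1 gen12 (memo `run/shared/lean/pub/rh-explicit/rh-explicit-weil-1/FORMAT-K3.md` §13).

THE IDEA.  In the RH anatomy of the prime-shift form (Bombieri's Dirichlet-form decomposition of Weil's functional + RH ⇒ Weil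
positivity, Literature `WeilMarkovQuadratic` / `WeilExplicitProofs`),

  `Q_b(u) + (2I₀ + log 4π + γ)‖u‖² + 2⟨u, sinh(·/2)⟩² ≤ 2⟨u, cosh(·/2)⟩² + ∫₀^∞ ρ_∞(t) D_t(u) dt`   (`u` a real Weil test on `[−b, b]`),

the POLE term is RANK ONE: `2⟨u, cosh(·/2)⟩² = 2(b + sinh b)·m` with `m = ⟨u, C_b⟩²/‖C_b‖² ≤ ‖u‖²` the energy of `u` along the cosh
profile `C_b = cosh(·/2)·1_{[−b,b]}` (`‖C_b‖² = b + sinh b`).  Writing `u = (⟨u,C_b⟩/‖C_b‖²)·C_b + r` (`‖r‖² = ‖u‖² − m`) the increments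
split (`integral_sq_shift_sub_le_split`):

  `D_t(u) ≤ (1 + 1/δ)·(m/‖C_b‖²)·D_t(C_b) + 4(1 + δ)·(‖u‖² − m)`   for every `t` and `δ > 0`,

so after cutting the archimedean integral at `t₀` (`primeShiftForm_add_le_of_RH_split`):

  `Q_b(u) + K‖u‖² ≤ 2(b + sinh b)·m + ∫₀^{t₀} ρ_∞ D_t(u) + (1 + 1/δ)·A·m + 4(1 + δ)Ψ(t₀)·(‖u‖² − m)`

whenever `∫_{t₀}^∞ ρ_∞ D_t(C_b) ≤ A·(b + sinh b)` (`Ψ(t₀) = ∫_{t₀}^∞ ρ_∞ ≤ ½log(1/t₀) + 2`).  The right side is AFFINE IN `m` with slope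
`2(b + sinh b) + (1 + 1/δ)A − 4(1 + δ)Ψ(t₀)`, nonnegative as soon as `e^b ≳ 2(1 + δ) log(1/t₀)`: the pole defect of the part of `u` off the cosh
direction pays for its archimedean energy, and `m ≤ ‖u‖²` gives (`primeShiftForm_le_of_RH_split`)

  `Q_b(u) ≤ (2(b + sinh b) + (1 + 1/δ)A − K)‖u‖² + ∫₀^{t₀} ρ_∞ D_t(u)`.

SEQUELS.  For an admissible `G` in a LINEAR-MODULUS CLASS `∫(G(x+t) − G(x))² ≤ (|t|/h)∫G²` (the RMS envelopes of `WeilFarFloorEnvelope`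
at scale `h`) mollification (`WeilFarFloorWindowSmoothing`) gives `B₀ ≤ θ∫G²` at the cut `t₀ = θh`, so the modulus scale enters ONLY
through the largeness condition `4(1 + δ)Ψ(θh) ≤ 2(b + sinh b)` (`h ≥ exp(−e^b/(5(1 + δ)))` suffices), not through the `log(1/h)` loss of
the plain envelope route; and `A ≤ 2I₀` for the cosh profile (its own archimedean energy), so the ceiling becomes
`e^b + 2b − log 4π − γ + o(1)` — the floor law C-XIII with the sharp constant, under RH.  This file: the split (RH-free, §1) and the RH step
for one Weil test (§2).  Standard axioms only; RH enters as Mathlib's `RiemannHypothesis`.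
-/

set_option linter.dupNamespace false
set_option autoImplicit false

noncomputable section

open MeasureTheory Set Filter
open scoped Real Topology ArithmeticFunction.vonMangoldt

namespace Summit.RiemannHypothesis.RiemannHypothesis.Theorems.WeilFormatC

namespace FloorCoshSplit

open Literature.NumberTheory.LFunctions FloorSmoothing FloorCosh FloorEnvelope

variable {b : ℝ}

/-! ## §1 Increments of admissible window functions and their split along a profile -/

/-- For a bounded measurable `f` vanishing off `[−b, b]`, `x ↦ f(x + s)·f(x + t)` is integrable. -/
theorem integrable_shiftAdd_mul_shiftAdd {f : ℝ → ℝ} {Cf : ℝ} (hf : Measurable f) (hCf : ∀ x, |f x| ≤ Cf)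
    (hfs : ∀ x, x ∉ Icc (-b) b → f x = 0) (s t : ℝ) :
    Integrable (fun x ↦ f (x + s) * f (x + t)) := by
  have h := integrable_shift_mul_shift hf hCf hfs (-s) (-t)
  refine h.congr (Eventually.of_forall fun x ↦ ?_)
  simp only [sub_neg_eq_add]

/-- The increment `∫ (f(x+t) − f(x))²` of a bounded measurable `f` vanishing off `[−b, b]`: the integrand is integrable. -/
theorem integrable_sq_shiftAdd_sub {f : ℝ → ℝ} {Cf : ℝ} (hf : Measurable f) (hCf : ∀ x, |f x| ≤ Cf)
    (hfs : ∀ x, x ∉ Icc (-b) b → f x = 0) (t : ℝ) :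
    Integrable (fun x ↦ (f (x + t) - f x) ^ 2) := by
  have h1 := integrable_shiftAdd_mul_shiftAdd hf hCf hfs t t
  have h2 := integrable_shiftAdd_mul_shiftAdd hf hCf hfs t 0
  have h3 := integrable_shiftAdd_mul_shiftAdd hf hCf hfs 0 0
  simp only [add_zero] at h2 h3
  refine ((h1.sub (h2.const_mul 2)).add h3).congr (Eventually.of_forall fun x ↦ ?_)
  simp only [Pi.add_apply, Pi.sub_apply]
  ring

/-- `∫ (f(x+t) − f(x))² ≤ 4∫f²` for a bounded measurable `f` vanishing off `[−b, b]`. -/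
theorem integral_sq_shiftAdd_sub_le_four_mul {f : ℝ → ℝ} {Cf : ℝ} (hf : Measurable f) (hCf : ∀ x, |f x| ≤ Cf)
    (hfs : ∀ x, x ∉ Icc (-b) b → f x = 0) (t : ℝ) :
    ∫ x, (f (x + t) - f x) ^ 2 ≤ 4 * ∫ x, f x ^ 2 := by
  have h1 := integrable_shiftAdd_mul_shiftAdd hf hCf hfs t t
  have h3 := integrable_shiftAdd_mul_shiftAdd hf hCf hfs 0 0
  simp only [add_zero] at h3
  have hsq : ∀ y, f y * f y = f y ^ 2 := fun y ↦ by ring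
  have e1 : ∫ x, f (x + t) * f (x + t) = ∫ x, f x ^ 2 := by
    rw [integral_add_right_eq_self (fun y ↦ f y * f y) t]; simp_rw [hsq]
  have e3 : ∫ x, f x * f x = ∫ x, f x ^ 2 := by simp_rw [hsq]
  calc ∫ x, (f (x + t) - f x) ^ 2 ≤ ∫ x, (2 * (f (x + t) * f (x + t)) + 2 * (f x * f x)) := by
        refine integral_mono (integrable_sq_shiftAdd_sub hf hCf hfs t) ((h1.const_mul 2).add (h3.const_mul 2)) fun x ↦ ?_
        nlinarith [sq_nonneg (f (x + t) + f x)]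
    _ = 4 * ∫ x, f x ^ 2 := by
        rw [integral_add (h1.const_mul 2) (h3.const_mul 2), integral_const_mul, integral_const_mul, e1, e3]; ring

/-- **The split of increments along a profile.**  Let `u` and `C` be bounded measurable functions vanishing off `[−b, b]` with
`∫ C² = P > 0`, and `m = (∫ u·C)²/P` the energy of `u` along `C`.  Then for every `t` and `δ > 0`
`∫ (u(x+t) − u(x))² ≤ (1 + 1/δ)·(m/P)·∫ (C(x+t) − C(x))² + 4(1 + δ)·(∫u² − m)`
(`u = (⟨u,C⟩/P)·C + r` with `∫ r² = ∫u² − m`, `(α + β)² ≤ (1 + 1/δ)α² + (1 + δ)β²`, `∫(r(·+t) − r)² ≤ 4∫r²`). -/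
theorem integral_sq_shift_sub_le_split {u C : ℝ → ℝ} {Cu CC P : ℝ} (hu : Measurable u) (hCu : ∀ x, |u x| ≤ Cu)
    (hus : ∀ x, x ∉ Icc (-b) b → u x = 0) (hC : Measurable C) (hCC : ∀ x, |C x| ≤ CC)
    (hCs : ∀ x, x ∉ Icc (-b) b → C x = 0) (hP : ∫ x, C x ^ 2 = P) (hP0 : 0 < P) {δ : ℝ} (hδ : 0 < δ) (t : ℝ) :
    ∫ x, (u (x + t) - u x) ^ 2
      ≤ (1 + 1 / δ) * ((∫ x, u x * C x) ^ 2 / P / P) * (∫ x, (C (x + t) - C x) ^ 2)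
        + 4 * (1 + δ) * ((∫ x, u x ^ 2) - (∫ x, u x * C x) ^ 2 / P) := by
  set c : ℝ := (∫ x, u x * C x) / P with hc
  set r : ℝ → ℝ := fun x ↦ u x - c * C x with hr
  -- `r` is admissible
  have hrm : Measurable r := hu.sub (measurable_const.mul hC)
  have hCu0 : 0 ≤ Cu := (abs_nonneg _).trans (hCu 0)
  have hCC0 : 0 ≤ CC := (abs_nonneg _).trans (hCC 0)
  have hrb : ∀ x, |r x| ≤ Cu + |c| * CC := fun x ↦ by
    calc |r x| = |u x - c * C x| := rfl
      _ ≤ |u x| + |c * C x| := abs_sub _ _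
      _ = |u x| + |c| * |C x| := by rw [abs_mul]
      _ ≤ Cu + |c| * CC := add_le_add (hCu x) (mul_le_mul_of_nonneg_left (hCC x) (abs_nonneg c))
  have hrs : ∀ x, x ∉ Icc (-b) b → r x = 0 := fun x hx ↦ by
    simp only [hr, hus x hx, hCs x hx, mul_zero, sub_zero]
  -- `∫ r² = ∫u² − (∫uC)²/P`
  have iuu := integrable_shiftAdd_mul_shiftAdd hu hCu hus 0 0
  have iCC := integrable_shiftAdd_mul_shiftAdd hC hCC hCs 0 0
  have iuC : Integrable fun x ↦ u x * C x := by
    have := integrable_shift_mul_shift_two hu hC hCu hCC hCs 0 0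
    simpa only [sub_zero] using this
  simp only [add_zero] at iuu iCC
  have hsqu : ∀ y, u y * u y = u y ^ 2 := fun y ↦ by ring
  have hsqC : ∀ y, C y * C y = C y ^ 2 := fun y ↦ by ring
  have iuu' : Integrable fun x ↦ u x ^ 2 := iuu.congr (Eventually.of_forall fun y ↦ hsqu y)
  have iCC' : Integrable fun x ↦ C x ^ 2 := iCC.congr (Eventually.of_forall fun y ↦ hsqC y)
  have hr2 : ∫ x, r x ^ 2 = (∫ x, u x ^ 2) - (∫ x, u x * C x) ^ 2 / P := by
    have e : ∀ x, r x ^ 2 = u x ^ 2 - 2 * c * (u x * C x) + c ^ 2 * C x ^ 2 := fun x ↦ by simp only [hr]; ring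
    simp_rw [e]
    rw [integral_add (f := fun x ↦ u x ^ 2 - 2 * c * (u x * C x)) (g := fun x ↦ c ^ 2 * C x ^ 2)
        (by exact iuu'.sub (iuC.const_mul _)) (iCC'.const_mul _),
      integral_sub (f := fun x ↦ u x ^ 2) (g := fun x ↦ 2 * c * (u x * C x)) iuu' (iuC.const_mul _),
      integral_const_mul, integral_const_mul, hP, hc]
    field_simp
    ring
  -- pointwise split and integration
  have hpt : ∀ x, (u (x + t) - u x) ^ 2
      ≤ (1 + 1 / δ) * (c ^ 2 * (C (x + t) - C x) ^ 2) + (1 + δ) * (r (x + t) - r x) ^ 2 := by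
    intro x
    have e : u (x + t) - u x = c * (C (x + t) - C x) + (r (x + t) - r x) := by simp only [hr]; ring
    rw [e]
    set α := c * (C (x + t) - C x)
    set β := r (x + t) - r x
    have hkey : 2 * (α * β) ≤ 1 / δ * α ^ 2 + δ * β ^ 2 := by
      have h1 : 0 ≤ (α - δ * β) ^ 2 / δ := div_nonneg (sq_nonneg _) hδ.le
      have h2 : (α - δ * β) ^ 2 / δ = 1 / δ * α ^ 2 - 2 * (α * β) + δ * β ^ 2 := by
        field_simp; ring
      linarith
    nlinarith [hkey]
  have iC := integrable_sq_shiftAdd_sub hC hCC hCs t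
  have ir := integrable_sq_shiftAdd_sub hrm hrb hrs t
  have hr4 := integral_sq_shiftAdd_sub_le_four_mul hrm hrb hrs t
  have hc2 : c ^ 2 = (∫ x, u x * C x) ^ 2 / P / P := by rw [hc]; field_simp
  have hδ1 : 0 ≤ 1 + δ := by linarith
  have hstep1 : ∫ x, (u (x + t) - u x) ^ 2
      ≤ (1 + 1 / δ) * (c ^ 2 * ∫ x, (C (x + t) - C x) ^ 2) + (1 + δ) * ∫ x, (r (x + t) - r x) ^ 2 := by
    calc ∫ x, (u (x + t) - u x) ^ 2
        ≤ ∫ x, ((1 + 1 / δ) * (c ^ 2 * (C (x + t) - C x) ^ 2) + (1 + δ) * (r (x + t) - r x) ^ 2) :=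
          integral_mono (integrable_sq_shiftAdd_sub hu hCu hus t) (((iC.const_mul _).const_mul _).add (ir.const_mul _)) hpt
      _ = (1 + 1 / δ) * (c ^ 2 * ∫ x, (C (x + t) - C x) ^ 2) + (1 + δ) * ∫ x, (r (x + t) - r x) ^ 2 := by
          rw [integral_add (f := fun x ↦ (1 + 1 / δ) * (c ^ 2 * (C (x + t) - C x) ^ 2))
              (g := fun x ↦ (1 + δ) * (r (x + t) - r x) ^ 2) ((iC.const_mul _).const_mul _) (ir.const_mul _),
            integral_const_mul, integral_const_mul, integral_const_mul]
  set I : ℝ := ∫ x, (C (x + t) - C x) ^ 2 with hI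
  set R : ℝ := ∫ x, (r (x + t) - r x) ^ 2 with hR
  set J : ℝ := ∫ x, u x * C x with hJ
  set Nu : ℝ := ∫ x, u x ^ 2 with hNu
  have hI0 : 0 ≤ I := integral_nonneg fun x ↦ sq_nonneg _
  have hcoef : 0 ≤ (1 + 1 / δ) * c ^ 2 := mul_nonneg (by positivity) (sq_nonneg _)
  rw [hc2] at hstep1 hcoef
  rw [hr2] at hr4
  have h2 := mul_le_mul_of_nonneg_left hr4 hδ1
  nlinarith [hstep1, h2, hcoef, hI0]

/-! ## §2 Under RH: the anatomy of the prime-shift form split along the cosh profile -/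

/-- A real Weil test of the window: continuous, measurable, bounded, vanishing off `[−b, b]`. -/
theorem weilTest_admissible {u : ℝ → ℝ} (hu : IsWeilTest fun x ↦ (u x : ℂ))
    (hus : tsupport (fun x ↦ (u x : ℂ)) ⊆ Icc (-b) b) :
    Continuous u ∧ Measurable u ∧ (∃ Cu : ℝ, ∀ x, |u x| ≤ Cu) ∧ (∀ x, x ∉ Icc (-b) b → u x = 0) := by
  have hc : Continuous u := (Complex.continuous_re.comp hu.1.continuous).congr fun x ↦ by simp
  obtain ⟨Cu, hCu⟩ := hu.1.continuous.bounded_above_of_compact_support hu.2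
  refine ⟨hc, hc.measurable, ⟨Cu, fun x ↦ ?_⟩, fun x hx ↦ ?_⟩
  · have := hCu x
    rwa [Complex.norm_real, Real.norm_eq_abs] at this
  · have h : (fun x ↦ (u x : ℂ)) x = 0 :=
      image_eq_zero_of_notMem_tsupport (f := fun x ↦ (u x : ℂ)) fun h ↦ hx (hus h)
    have h' : (u x : ℂ) = 0 := h
    exact_mod_cast h'

/-- **UNDER RH: THE PRIME-SHIFT FORM SPLIT ALONG THE COSH PROFILE.**  For a real Weil test `u` supported in `[−b, b]` (`b > 0`),
`δ > 0`, `t₀ > 0`, a small-scale budget `∫_{(0,t₀]} ρ_∞ D_t(u) ≤ B₀` and a large-scale budget `∫_{(t₀,∞)} ρ_∞ D_t(C_b) ≤ A·(b + sinh b)`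
for the cosh profile `C_b = cosh(·/2)·1_{[−b,b]}`:
`Q_b(u) + (2I₀ + log 4π + γ)∫u² ≤ 2(b + sinh b)·m + B₀ + (1 + 1/δ)·A·m + 4(1 + δ)·Ψ(t₀)·(∫u² − m)`,
`m = (∫ u·C_b)²/(b + sinh b)` (`Ψ = weilArchTail`).  RH anatomy (Bombieri's Dirichlet form + Weil positivity; the zero energy and
`2(∫u·sinh(·/2))²` are dropped) + the rank-one pole `2(∫u·cosh(·/2))² = 2(b + sinh b)·m` + the increment split of §1. -/
theorem primeShiftForm_add_le_of_RH_split (hRH : RiemannHypothesis) (hb : 0 < b) {u : ℝ → ℝ}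
    (hu : IsWeilTest fun x ↦ (u x : ℂ)) (hus : tsupport (fun x ↦ (u x : ℂ)) ⊆ Icc (-b) b)
    {δ t₀ A B₀ : ℝ} (hδ : 0 < δ) (ht₀ : 0 < t₀)
    (hB₀ : ∫ t in Ioc 0 t₀, weilArchDensity t * ∫ x, (u (x + t) - u x) ^ 2 ≤ B₀)
    (hCint : IntegrableOn (fun t ↦ weilArchDensity t
        * ∫ x, ((Icc (-b) b).indicator (fun y ↦ Real.cosh (y / 2)) (x + t)
            - (Icc (-b) b).indicator (fun y ↦ Real.cosh (y / 2)) x) ^ 2) (Ioi t₀))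
    (hA : ∫ t in Ioi t₀, weilArchDensity t
        * ∫ x, ((Icc (-b) b).indicator (fun y ↦ Real.cosh (y / 2)) (x + t)
            - (Icc (-b) b).indicator (fun y ↦ Real.cosh (y / 2)) x) ^ 2 ≤ A * (b + Real.sinh b)) :
    primeShiftForm b u
        + (2 * (∫ t in Ioi (0 : ℝ), (Real.exp (t / 2) - 1) / (2 * Real.sinh t))
            + (Real.log (4 * π) + Real.eulerMascheroniConstant)) * (∫ x, u x ^ 2)
      ≤ 2 * (b + Real.sinh b)
            * ((∫ x, u x * (Icc (-b) b).indicator (fun y ↦ Real.cosh (y / 2)) x) ^ 2 / (b + Real.sinh b))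
        + B₀
        + (1 + 1 / δ) * A
            * ((∫ x, u x * (Icc (-b) b).indicator (fun y ↦ Real.cosh (y / 2)) x) ^ 2 / (b + Real.sinh b))
        + 4 * (1 + δ) * weilArchTail t₀
            * ((∫ x, u x ^ 2)
              - (∫ x, u x * (Icc (-b) b).indicator (fun y ↦ Real.cosh (y / 2)) x) ^ 2 / (b + Real.sinh b)) := by
  set C : ℝ → ℝ := (Icc (-b) b).indicator (fun y ↦ Real.cosh (y / 2)) with hCdef
  set P : ℝ := b + Real.sinh b with hPdef
  have hP0 : 0 < P := by have := Real.sinh_pos_iff.2 hb; rw [hPdef]; linarith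
  obtain ⟨hCm, hCb, hCs⟩ := coshTest_admissible b
  have hCP : ∫ x, C x ^ 2 = P := integral_coshTest_sq hb.le
  obtain ⟨huc, hum, ⟨Cu, hCu⟩, hus0⟩ := weilTest_admissible hu hus
  set N : ℝ := ∫ x, u x ^ 2 with hNdef
  set J : ℝ := ∫ x, u x * C x with hJdef
  -- (1) the RH anatomy: `Q + K N + 2(∫u sinh)² ≤ 2(∫u cosh)² + ARCH`
  have hpos : 0 ≤ (weilQuadratic fun x ↦ (u x : ℂ)).re :=
    WeilPositivity.of_riemannHypothesis explicit_formula_holds hRH _ hu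
  rw [weilQuadratic_re_eq_weilPoleForm_add_weilDirichletEnergy_sub hu hus] at hpos
  have hpole : weilPoleForm (fun x ↦ (u x : ℂ))
      = 2 * (∫ t, u t * Real.cosh (t / 2)) ^ 2 - 2 * (∫ t, u t * Real.sinh (t / 2)) ^ 2 := by
    have hC' : (∫ t, (u t : ℂ) * (Real.cosh (t / 2) : ℂ)) = ((∫ t, u t * Real.cosh (t / 2) : ℝ) : ℂ) := by
      rw [← integral_complex_ofReal]; exact integral_congr_ae (ae_of_all _ fun t ↦ by push_cast; ring)
    have hS' : (∫ t, (u t : ℂ) * (Real.sinh (t / 2) : ℂ)) = ((∫ t, u t * Real.sinh (t / 2) : ℝ) : ℂ) := by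
      rw [← integral_complex_ofReal]; exact integral_congr_ae (ae_of_all _ fun t ↦ by push_cast; ring)
    rw [weilPoleForm, hC', hS', Complex.norm_real, Complex.norm_real, Real.norm_eq_abs, Real.norm_eq_abs, sq_abs, sq_abs]
  have hnorm : (∫ x, ‖((u x : ℂ))‖ ^ 2) = N :=
    integral_congr_ae (ae_of_all _ fun x ↦ by simp only [Complex.norm_real, Real.norm_eq_abs, sq_abs])
  -- increments of the complexification are the real increments
  have hinc : ∀ t, weilIncrement (fun x ↦ (u x : ℂ)) t = ∫ x, (u (x + t) - u x) ^ 2 := fun t ↦ by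
    unfold weilIncrement
    exact integral_congr_ae (Eventually.of_forall fun x ↦ by
      simp only [← Complex.ofReal_sub, Complex.norm_real, Real.norm_eq_abs, sq_abs])
  -- `D_{log n}(u) = 2N − 2∫u(x − log n)u(x)`
  have hincQ : ∀ t, ∫ x, (u (x + t) - u x) ^ 2 = 2 * N - 2 * ∫ x, u (x - t) * u x := by
    intro t
    have i1 := integrable_shiftAdd_mul_shiftAdd hum hCu hus0 t t
    have i2 := integrable_shiftAdd_mul_shiftAdd hum hCu hus0 t 0
    have i3 := integrable_shiftAdd_mul_shiftAdd hum hCu hus0 0 0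
    simp only [add_zero] at i2 i3
    have hsq : ∀ y, u y * u y = u y ^ 2 := fun y ↦ by ring
    have e1 : ∫ x, u (x + t) * u (x + t) = N := by
      rw [integral_add_right_eq_self (fun y ↦ u y * u y) t]; simp_rw [hsq]; rfl
    have e2 : ∫ x, u (x + t) * u x = ∫ x, u (x - t) * u x := by
      rw [← integral_add_right_eq_self (fun y ↦ u (y + t) * u y) (-t)]
      refine integral_congr_ae (Eventually.of_forall fun x ↦ ?_)
      show u (x + -t + t) * u (x + -t) = u (x - t) * u x
      rw [neg_add_cancel_right, ← sub_eq_add_neg, mul_comm]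
    have e3 : ∫ x, u x * u x = N := by simp_rw [hsq]; rfl
    have e : ∀ x, (u (x + t) - u x) ^ 2 = u (x + t) * u (x + t) - 2 * (u (x + t) * u x) + u x * u x := fun x ↦ by ring
    simp_rw [e]
    rw [integral_add (f := fun x ↦ u (x + t) * u (x + t) - 2 * (u (x + t) * u x)) (g := fun x ↦ u x * u x)
        (i1.sub (i2.const_mul 2)) i3,
      integral_sub (f := fun x ↦ u (x + t) * u (x + t)) (g := fun x ↦ 2 * (u (x + t) * u x)) i1 (i2.const_mul 2),
      integral_const_mul, e1, e2, e3]
    ring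
  have hQ : primeShiftForm b u = 2 * N * (∑ n ∈ weilPrimeIndex b, (Λ n : ℝ) / Real.sqrt n)
      - ∑ n ∈ weilPrimeIndex b, (Λ n : ℝ) / Real.sqrt n * weilIncrement (fun x ↦ (u x : ℂ)) (Real.log n) := by
    unfold primeShiftForm
    rw [Finset.mul_sum, ← Finset.sum_sub_distrib]
    refine Finset.sum_congr rfl fun n _ ↦ ?_
    rw [hinc, hincQ]; ring
  unfold weilDirichletEnergy weilMarkovConstant at hpos
  rw [hpole, hnorm] at hpos
  -- (2) the pole coefficient is `J`: `∫ u·cosh(·/2) = ∫ u·C_b`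
  have hJ : (∫ t, u t * Real.cosh (t / 2)) = J := by
    refine integral_congr_ae (Eventually.of_forall fun x ↦ ?_)
    by_cases hx : x ∈ Icc (-b) b
    · simp only [hCdef, indicator_of_mem hx]
    · simp only [hus0 x hx, zero_mul]
  rw [hJ] at hpos
  -- (3) the archimedean energy, split at `t₀`
  set ARCH := ∫ t in Ioi (0 : ℝ), weilArchDensity t * weilIncrement (fun x ↦ (u x : ℂ)) t with hARCH
  have hAi : IntegrableOn (fun t ↦ weilArchDensity t * weilIncrement (fun x ↦ (u x : ℂ)) t) (Ioi 0) :=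
    integrableOn_weilArchDensity_mul_weilIncrement hu
  have hAi' : IntegrableOn (fun t ↦ weilArchDensity t * ∫ x, (u (x + t) - u x) ^ 2) (Ioi 0) :=
    hAi.congr_fun (fun t _ ↦ by simp only [hinc]) measurableSet_Ioi
  have hsplit : ARCH = (∫ t in Ioc 0 t₀, weilArchDensity t * ∫ x, (u (x + t) - u x) ^ 2)
      + ∫ t in Ioi t₀, weilArchDensity t * ∫ x, (u (x + t) - u x) ^ 2 := by
    rw [hARCH, setIntegral_congr_fun measurableSet_Ioi
        (f := fun t ↦ weilArchDensity t * weilIncrement (fun x ↦ (u x : ℂ)) t)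
        (g := fun t ↦ weilArchDensity t * ∫ x, (u (x + t) - u x) ^ 2) (fun t _ ↦ by simp only [hinc]),
      ← Ioc_union_Ioi_eq_Ioi ht₀.le,
      setIntegral_union (Ioc_disjoint_Ioi le_rfl) measurableSet_Ioi (hAi'.mono_set Ioc_subset_Ioi_self)
        (hAi'.mono_set (Ioi_subset_Ioi ht₀.le))]
  -- (4) the large scales: the split of §1 under `ρ_∞ ≥ 0`
  have hlarge : ∫ t in Ioi t₀, weilArchDensity t * ∫ x, (u (x + t) - u x) ^ 2
      ≤ (1 + 1 / δ) * (J ^ 2 / P / P) * (A * P) + 4 * (1 + δ) * (N - J ^ 2 / P) * weilArchTail t₀ := by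
    have hmaj : IntegrableOn (fun t ↦ (1 + 1 / δ) * (J ^ 2 / P / P) * (weilArchDensity t
          * ∫ x, (C (x + t) - C x) ^ 2) + 4 * (1 + δ) * (N - J ^ 2 / P) * weilArchDensity t) (Ioi t₀) :=
      (hCint.const_mul _).add ((integrableOn_weilArchDensity_Ioi ht₀).const_mul _)
    calc ∫ t in Ioi t₀, weilArchDensity t * ∫ x, (u (x + t) - u x) ^ 2
        ≤ ∫ t in Ioi t₀, ((1 + 1 / δ) * (J ^ 2 / P / P) * (weilArchDensity t * ∫ x, (C (x + t) - C x) ^ 2)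
            + 4 * (1 + δ) * (N - J ^ 2 / P) * weilArchDensity t) := by
          refine setIntegral_mono_on (hAi'.mono_set (Ioi_subset_Ioi ht₀.le)) hmaj measurableSet_Ioi fun t ht ↦ ?_
          have hρ := (weilArchDensity_pos (ht₀.trans ht)).le
          have hs := integral_sq_shift_sub_le_split hum hCu hus0 hCm hCb hCs hCP hP0 hδ t
          have := mul_le_mul_of_nonneg_left hs hρ
          linarith
      _ = (1 + 1 / δ) * (J ^ 2 / P / P) * (∫ t in Ioi t₀, weilArchDensity t * ∫ x, (C (x + t) - C x) ^ 2)
            + 4 * (1 + δ) * (N - J ^ 2 / P) * weilArchTail t₀ := by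
          rw [integral_add (hCint.const_mul _) ((integrableOn_weilArchDensity_Ioi ht₀).const_mul _),
            integral_const_mul, integral_const_mul]
          rfl
      _ ≤ (1 + 1 / δ) * (J ^ 2 / P / P) * (A * P) + 4 * (1 + δ) * (N - J ^ 2 / P) * weilArchTail t₀ := by
          have hcoef : 0 ≤ (1 + 1 / δ) * (J ^ 2 / P / P) := by positivity
          have := mul_le_mul_of_nonneg_left hA hcoef
          linarith
  -- (5) bookkeeping
  have hJ2 : 2 * J ^ 2 = 2 * P * (J ^ 2 / P) := by field_simp
  have hAP : (1 + 1 / δ) * (J ^ 2 / P / P) * (A * P) = (1 + 1 / δ) * A * (J ^ 2 / P) := by field_simp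
  have hsinh2 : 0 ≤ 2 * (∫ t, u t * Real.sinh (t / 2)) ^ 2 := by positivity
  set E := ∑ n ∈ weilPrimeIndex b, (Λ n : ℝ) / Real.sqrt n * weilIncrement (fun x ↦ (u x : ℂ)) (Real.log n) with hE
  set W := ∑ n ∈ weilPrimeIndex b, (Λ n : ℝ) / Real.sqrt n with hW
  rw [hsplit, hJ2] at hpos
  rw [hAP] at hlarge
  linarith [hpos, hQ, hlarge, hB₀, hsinh2]

/-- **The `O(1)` ceiling for one Weil test, small scales set aside.**  In the situation of `primeShiftForm_add_le_of_RH_split`, if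
`A ≥ 0` and the window is large against the cut, `4(1 + δ)Ψ(t₀) ≤ 2(b + sinh b)`, then
`Q_b(u) ≤ (2(b + sinh b) + (1 + 1/δ)A − (2I₀ + log 4π + γ))·∫u² + B₀`:
the bound of the split is affine in `m = (∫u·C_b)²/(b + sinh b) ∈ [0, ∫u²]` with nonnegative slope. -/
theorem primeShiftForm_le_of_RH_split (hRH : RiemannHypothesis) (hb : 0 < b) {u : ℝ → ℝ}
    (hu : IsWeilTest fun x ↦ (u x : ℂ)) (hus : tsupport (fun x ↦ (u x : ℂ)) ⊆ Icc (-b) b)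
    {δ t₀ A B₀ : ℝ} (hδ : 0 < δ) (ht₀ : 0 < t₀) (hA0 : 0 ≤ A)
    (hbig : 4 * (1 + δ) * weilArchTail t₀ ≤ 2 * (b + Real.sinh b))
    (hB₀ : ∫ t in Ioc 0 t₀, weilArchDensity t * ∫ x, (u (x + t) - u x) ^ 2 ≤ B₀)
    (hCint : IntegrableOn (fun t ↦ weilArchDensity t
        * ∫ x, ((Icc (-b) b).indicator (fun y ↦ Real.cosh (y / 2)) (x + t)
            - (Icc (-b) b).indicator (fun y ↦ Real.cosh (y / 2)) x) ^ 2) (Ioi t₀))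
    (hA : ∫ t in Ioi t₀, weilArchDensity t
        * ∫ x, ((Icc (-b) b).indicator (fun y ↦ Real.cosh (y / 2)) (x + t)
            - (Icc (-b) b).indicator (fun y ↦ Real.cosh (y / 2)) x) ^ 2 ≤ A * (b + Real.sinh b)) :
    primeShiftForm b u
      ≤ (2 * (b + Real.sinh b) + (1 + 1 / δ) * A
          - (2 * (∫ t in Ioi (0 : ℝ), (Real.exp (t / 2) - 1) / (2 * Real.sinh t))
              + (Real.log (4 * π) + Real.eulerMascheroniConstant))) * (∫ x, u x ^ 2) + B₀ := by
  have hkey := primeShiftForm_add_le_of_RH_split hRH hb hu hus hδ ht₀ hB₀ hCint hA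
  set C : ℝ → ℝ := (Icc (-b) b).indicator (fun y ↦ Real.cosh (y / 2)) with hCdef
  set P : ℝ := b + Real.sinh b with hPdef
  have hP0 : 0 < P := by have := Real.sinh_pos_iff.2 hb; rw [hPdef]; linarith
  obtain ⟨hCm, hCb, hCs⟩ := coshTest_admissible b
  have hCP : ∫ x, C x ^ 2 = P := integral_coshTest_sq hb.le
  obtain ⟨-, hum, ⟨Cu, hCu⟩, hus0⟩ := weilTest_admissible hu hus
  set N : ℝ := ∫ x, u x ^ 2 with hNdef
  set J : ℝ := ∫ x, u x * C x with hJdef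
  -- Bessel: `m = J²/P ≤ N`
  have iuu : Integrable fun x ↦ u x ^ 2 := by
    have := integrable_shiftAdd_mul_shiftAdd hum hCu hus0 0 0
    simp only [add_zero] at this
    exact this.congr (Eventually.of_forall fun y ↦ by simp only; ring)
  have iCC : Integrable fun x ↦ C x ^ 2 := by
    have := integrable_shiftAdd_mul_shiftAdd hCm hCb hCs 0 0
    simp only [add_zero] at this
    exact this.congr (Eventually.of_forall fun y ↦ by simp only; ring)
  have iuC : Integrable fun x ↦ u x * C x := by
    have := integrable_shift_mul_shift_two hum hCm hCu hCb hCs 0 0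
    simpa only [sub_zero] using this
  have hJ2 : J ^ 2 ≤ N * P := by rw [← hCP]; exact sq_integral_mul_le iuu iuC iCC
  have hmN : J ^ 2 / P ≤ N := by rw [div_le_iff₀ hP0]; exact hJ2
  have hm0 : 0 ≤ J ^ 2 / P := div_nonneg (sq_nonneg _) hP0.le
  have hΨ0 : 0 ≤ weilArchTail t₀ :=
    setIntegral_nonneg measurableSet_Ioi fun t ht ↦ (weilArchDensity_pos (ht₀.trans ht)).le
  have hδ' : 0 ≤ 1 + 1 / δ := by positivity
  have hslope : 0 ≤ 2 * P + (1 + 1 / δ) * A - 4 * (1 + δ) * weilArchTail t₀ := by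
    nlinarith [mul_nonneg hδ' hA0]
  have hgain := mul_nonneg hslope (sub_nonneg.2 hmN)
  nlinarith [hkey, hgain]

end FloorCoshSplit

end Summit.RiemannHypothesis.RiemannHypothesis.Theorems.WeilFormatC
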